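import Summits.QuantumFields.YangMills.Theorems.BalabanUVNodesN12ClassLetterTowerContinuity
import Summits.QuantumFields.YangMills.Theorems.AlphaInputsT3ACv3LocalSmallBoxes
import Literature.MathematicalPhysics.QuantumFieldTheory.Balaban1983to89.Node00.LargeFieldBackgroundCoPOfRecord
import HarnessLib

/-!
# BalabanUVNodes ∕ N12 — THE CLASS LETTERS OF THE w1 LINEAGE's CHART THEOREM, PART 2: AT THE CLOSED READING OF NODE 00's (2.12) CLASS
# ([Balaban1985Variational] (2), (6)–(7) pp. 278–279; [Balaban1985RegularSpaces] (1.7) p. 77; [Balaban1985Averaging] Prop. 2 (52)–(54) p. 26; [Balaban1988Convergent] (2.12) p. 256)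

Cell `pub-ymgap` (HUMAN RULINGS D-0062 ∕ D-0149), WIDTH SEAT `pub-ymgap-dag-n12-w1` g4 (node N12 = [B15]; key K1⁹ `stmt-QuantumFields-27364`, `--kind proof --supports … --as helper`;
count-neutral).  THEOREMS ONLY (0 `def`, 0 `instance`, 0 `sorry`); consumed BY NAME: Part 1 (`…N12ClassLetterTowerContinuity`), NODE 00's class `Node00.regMSCoPOfRecordAt` ∕
`regMSCoPOfRecord` (`Node00/LargeFieldBackgroundCoPOfRecord`, node00-def-R), dag-n07-e's `…N07DirectMethod.continuous_dist1_plaqHol`.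

WHY.  The lineage's chart theorems `B15Prop1MinimiserFamilyFromThm1AtBaseCentral.hMin_atRecord_of_node00Letters_thm1AtBase_central` (p631475) ∕ `…N12RightInverseLetterOfForest.…_central_surj`
(p633254) take a closed reading class `reg'` of NODE 00's STRICT (2.12) class `reg = Node00.regMSCoPOfRecord F 2 ν Kt kc Ω` with three letters: `hreg' : IsClosed reg'`,
`hcl : closure reg ⊆ reg'`, `hDreg' : ContinuousOn (fun U i => ↑(Ū U)_{(j_i,c_i)}) reg'`; print's Theorem 1 at the base datum, (T1@q₀), is then quantified over `reg'`, so the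
consumer wants `reg'` as SMALL as possible.  THIS FILE takes the smallest admissible one, `reg' := closure reg`, for which `hreg'` and `hcl` are trivial, and discharges `hDreg'` from
Part 1 modulo ONE combinatorial geometry letter and k-INDEPENDENT numerics on `ν.εreg`: the closure of the strict class lies in its closed (≤) (1.7)-companion (§1–§2); a member of
the closed companion has its fine plaquettes within `εreg·η_{j′}²` on `plaqsOf (topSeq Ω₀ Ω j′)`, hence within `2L²εreg·η_j²` on any plaquette set lying in the levels `j′ ≥ j − 1`
(§3: the base collar of the tower under a level-`j` constrained bond may straddle `Ω_j` and `Ω_{j−1}∖Ω_j`); Part 1 (dag-n11-d's LOCAL [B7] Prop. 2 + the (0.4) guard + dag-n07-e's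
continuity brick down the tower) then gives continuity at every point of the closure (§4).

THE GEOMETRY LETTER `hgeom` (displayed, per constrained bond `(j, c)` of `𝐁`, `j ≤ k`): a bond family `B` through `c` closed downward under the (0.4) window below `j`, a plaquette
family `S` containing the three blocks of every `B`-bond and box-closed below `j` (dag-n20-d's one-step boxes of radius `(d+4)L + 2`), whose fine member `S 0` lies in
`⋃_{j′ ≤ kc, j ≤ j′+1} plaqsOf (topSeq Ω₀ Ω j′)`.  At the record (`𝐁 = Bj ν.M₁ Z k`, `Ω = maxDomT ν.M₁ Z`, [III] (2.13)) it is lattice geometry of the (2.2) cubes and the (2.13)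
separation (the tower base collar of a `Γ_j`-cube — about `(d+6)` level-`j` blocks around it — must lie in `Ω_{j−1}`); NOT inhabited here.

CONTENTS.  §1 `isClosed_setOf_forall_plaqLeOn` · §2 `closure_regMSCoPOfRecordAt_subset_plaqLe`, `dist1_plaqHol_le_of_mem_closure_regMSCoPOfRecordAt` · §3 `eta_le_L_mul_eta`,
★ `plaqSmallOn_of_mem_closure_regMSCoPOfRecordAt_of_subset_levels` · §4 ★★★ `continuousOn_constrainedAverages_closure_regMSCoPOfRecordAt`, ★★★ `…_regMSCoPOfRecord` (the support of
record), ★★★ `classLetters_closure_regMSCoPOfRecord` (the TRIPLE in the binder order of E″∕I).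

HONEST FRAMING.  Point-set topology and bookkeeping over Part 1 and NODE 00's definitions; the geometry letter and the numerics are DISPLAYED; nothing of Bałaban's estimates asserted
beyond the tree's kernel theorems; N12 NOT discharged; K1⁹ NOT closed; counts unmoved; one finite 𝕋⁴ programme at fixed ε — R4 closes the conditional rung `BalabanLadder.UV` only; the
Yang–Mills mass gap (Clay) is NOT proved by any of this; nothing continuum ∕ ℝ⁴ ∕ OS.
-/

noncomputable section

namespace Summit.QuantumFields.YangMills.BalabanUVNodes.N12ClassLettersAtClosedClassOfRecord

open Set Filter Topology
open Literature.MathematicalPhysics.QuantumFieldTheory.Balaban1983to89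
open Literature.MathematicalPhysics.QuantumFieldTheory.Balaban1983to89.T4Continuum (T4Family)
open Literature.MathematicalPhysics.QuantumFieldTheory.Balaban1983to89.Node00
open Literature.MathematicalPhysics.QuantumFieldTheory.Balaban1983to89.BlockAveraging (blockAvg Small)
open Literature.MathematicalPhysics.QuantumFieldTheory.Balaban1983to89.ExpMeanLog (expMeanLogSU deltaSU)
open Literature.MathematicalPhysics.QuantumFieldTheory.Balaban1983to89.B15DeterminingSets (DetSet MSField avgFamily bondsOf)
open Literature.MathematicalPhysics.QuantumFieldTheory.Balaban1983to89.B8Eq17ClassAkV1 (plaqsOf)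
open Summit.QuantumFields.YangMills.BalabanUVNodes.N07DirectMethod (continuous_dist1_plaqHol)
open Summit.QuantumFields.YangMills.BalabanUVNodes.N12ClassLetterTowerContinuity (continuousOn_constrainedAverages_of_towerGuards small_iter_of_plaqSmallOn_boxClosed
  stokes_two_mul_lt_deltaSU)
open Summit.QuantumFields.YangMills.Theorems.N21LocalAveragedRegularity (plaqSmallOn_iter_avOfRecord_loc)
open Summit.QuantumFields.YangMills.Theorems.LocalSmallLoop (mem_boxRegion_of_blockOf_near)
open Literature.MathematicalPhysics.QuantumFieldTheory.Balaban1983to89.BlockAveragingPlaquetteBoundLocal (small_of_plaqSmallOn_blocks)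
open Summit.QuantumFields.YangMills.BalabanUVNodes.N20LCSAvgDominationRegion (boxRegion)
open scoped Matrix.Norms.L2Operator

variable {F : T4Family} {N : ℕ} [NeZero N] {K : ℕ}

/-! ## §0  The (0.4) guard at ONE tower bond from the per-bond LOCAL Proposition 2 (the «cone box» packaging) -/

omit [NeZero N] in
/-- `η_j ≤ η_i` for `i ≤ j` (`η_l = L^{−l}`, `1 ≤ L`). [folklore] -/
theorem eta_le_eta_of_le {i j : ℕ} (h : i ≤ j) : (F.P K).eta j ≤ (F.P K).eta i := by
  have hL : (1 : ℝ) ≤ (F.P K).L := by exact_mod_cast (F.P K).L_pos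
  unfold Params.eta
  exact pow_le_pow_of_le_one (by positivity) (inv_le_one_of_one_le₀ hL) h

/-- ★★ **THE (0.4) GUARD AT ONE TOWER BOND FROM THE PER-BOND LOCAL PROPOSITION 2** («cone box» packaging, no box-closed family): for a bond `c′` of level `i + 1`
(standing range) and the chain of block centres `xs` below `emb c′₋` (`xs i = emb c′₋`, `xs l = emb (xs (l+1))`), if the fine plaquettes of `U` are `α₀η_i²`-small on the fine box
`boxRegion (xs 0) (Lⁱ(2L + (d+4)L + 2))` with `C₀(d)α₀ ≤ ⅓`, `2α₀ ≤ c′₂`, then `Small ℰp (Ū^i U) c′`: dag-n21-c's per-bond local Prop. 2 `plaqSmallOn_iter_avOfRecord_loc` gives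
`|Ū^i(∂p′) − 1| < 2α₀` on `boxRegion (emb c′₋) (2L)`, which holds the three blocks the (0.4) loops at `c′` visit (alpha-2's `mem_boxRegion_of_blockOf_near`), and
`small_of_plaqSmallOn_blocks` closes. [cite: Balaban1985Averaging, Prop. 2 (52)–(54) p.26 («it is enough to assume (52) for p ⊂ B^k(x) ∪ …»); Balaban1987RG1, (0.3)–(0.4) pp.252–253] -/
theorem small_iter_of_plaqSmallOn_coneBox {i : ℕ} (hi : i + 1 ≤ (F.P K).m + (F.P K).K) (c' : PBond (F.P K) (i + 1))
    (xs : (l : ℕ) → Site (F.P K) l) (hxi : xs i = emb c'.src) (hxs : ∀ l < i, xs l = emb (xs (l + 1)))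
    {α₀ : ℝ} (hα : 0 < α₀) (hα3 : (143 * (((((F.P K).d + 4 : ℕ) : ℝ)) ^ 2 / 4) ^ 2) * α₀ ≤ 1 / 3)
    (hα2 : 2 * α₀ ≤ 2 * deltaSU (Fin N) / ((((F.P K).d + 4) * (F.P K).L : ℕ) : ℝ) ^ 2)
    {U : GaugeField (F.P K) 0 (SU N)}
    (h52 : PlaqSmallOn (↑(boxRegion (xs 0) ((F.P K).L ^ i * (2 * (F.P K).L + (((F.P K).d + 4) * (F.P K).L + 2)))) : Set (Plaq (F.P K) 0))
      (α₀ * (F.P K).eta i ^ 2) U) :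
    Small (expMeanLogSU (n := Fin N)) (Averaging.iter (avOfRecord F N K) i U) c' := by
  have hP := plaqSmallOn_iter_avOfRecord_loc (F := F) (N := N) K i hα hα3 hα2 xs hxs (2 * (F.P K).L) h52
  rw [hxi] at hP
  exact small_of_plaqSmallOn_blocks (expMeanLogSU (n := Fin N)) (δ := 2 * α₀) (by positivity) hi c'
    (fun q hq => hP q (Finset.mem_coe.mpr (mem_boxRegion_of_blockOf_near hi c' hq))) (stokes_two_mul_lt_deltaSU hα hα2)

/-! ## §1  Closed (≤) plaquette classes -/

/-- **A LEVEL-INDEXED NON-STRICT PLAQUETTE CLASS IS CLOSED**: `{U | ∀ j ≤ k, ∀ p ∈ A_j, |U(∂p) − 1| ≤ δ_j}` is closed in the configuration space (finitely many non-strict inequalities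
between continuous functions) — the closed companion of print's strict class (2). [cite: Balaban1985Variational, (2) p.278; Balaban1985RegularSpaces, (1.7) p.77] -/
theorem isClosed_setOf_forall_plaqLeOn {P : Params} {l : ℕ} (A : ℕ → Set (Plaq P l)) (δ : ℕ → ℝ) (k : ℕ) :
    IsClosed {U : GaugeField P l (SU N) | ∀ j, j ≤ k → ∀ p ∈ A j, dist1 (GaugeField.plaqHol U p) ≤ δ j} := by
  have h : {U : GaugeField P l (SU N) | ∀ j, j ≤ k → ∀ p ∈ A j, dist1 (GaugeField.plaqHol U p) ≤ δ j} =
      ⋂ j, ⋂ (_ : j ≤ k), ⋂ p ∈ A j, {U : GaugeField P l (SU N) | dist1 (GaugeField.plaqHol U p) ≤ δ j} := by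
    ext U; simp only [mem_setOf_eq, mem_iInter]
  rw [h]
  exact isClosed_iInter fun j => isClosed_iInter fun _ => isClosed_biInter fun p _ =>
    isClosed_le (continuous_dist1_plaqHol p) continuous_const

/-! ## §2  The closure of NODE 00's strict class lies in its closed (1.7)-companion -/

/-- **`closure (regMSCoPOfRecordAt …) ⊆` THE CLOSED (1.7)-CLASS**: every configuration in the closure of NODE 00's strict (2.12) class on a support `Ω₀` satisfies the NON-STRICT (1.7)
bounds `|U(∂p) − 1| ≤ εreg·η_j²` on `plaqsOf (topSeq Ω₀ Ω j)`, `j ≤ kc` (the (1.9) half is not needed for continuity and is dropped).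
[cite: Balaban1985Variational, (2), (6) p.278; Balaban1985RegularSpaces, (1.7) p.77; Balaban1988Convergent, (2.12) p.256] -/
theorem closure_regMSCoPOfRecordAt_subset_plaqLe (ν : Stage7Numerics) (kc : ℕ) (Ω₀ : Set (Site (F.P K) 0)) (Ω : ℕ → Set (Site (F.P K) 0)) :
    closure (regMSCoPOfRecordAt F N ν K kc Ω₀ Ω) ⊆
      {U | ∀ j, j ≤ kc → ∀ p ∈ plaqsOf (topSeq Ω₀ Ω j), dist1 (GaugeField.plaqHol U p) ≤ ν.εreg * (F.P K).eta j ^ 2} :=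
  closure_minimal (fun _ hU j hj p hp => (hU.1 j hj p hp).le) (isClosed_setOf_forall_plaqLeOn _ _ kc)

/-- Pointwise form of §2. [cite: Balaban1985Variational, (2) p.278; Balaban1985RegularSpaces, (1.7) p.77] -/
theorem dist1_plaqHol_le_of_mem_closure_regMSCoPOfRecordAt {ν : Stage7Numerics} {kc : ℕ} {Ω₀ : Set (Site (F.P K) 0)} {Ω : ℕ → Set (Site (F.P K) 0)}
    {U : GaugeField (F.P K) 0 (SU N)} (hU : U ∈ closure (regMSCoPOfRecordAt F N ν K kc Ω₀ Ω)) {j : ℕ} (hj : j ≤ kc)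
    {p : Plaq (F.P K) 0} (hp : p ∈ plaqsOf (topSeq Ω₀ Ω j)) :
    dist1 (GaugeField.plaqHol U p) ≤ ν.εreg * (F.P K).eta j ^ 2 :=
  closure_regMSCoPOfRecordAt_subset_plaqLe ν kc Ω₀ Ω hU j hj p hp

/-! ## §3  The fine bound on a tower base lying in the levels `j′ ≥ j − 1` -/

omit [NeZero N] in
/-- `η_{j′} ≤ L·η_j` whenever `j ≤ j′ + 1` (`η_i = L^{−i}`, `1 ≤ L`). [folklore] -/
theorem eta_le_L_mul_eta {j j' : ℕ} (h : j ≤ j' + 1) : (F.P K).eta j' ≤ ((F.P K).L : ℝ) * (F.P K).eta j := by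
  have hL : (1 : ℝ) ≤ (F.P K).L := by exact_mod_cast (F.P K).L_pos
  have hL0 : (0 : ℝ) < (F.P K).L := by linarith
  have hx0 : (0 : ℝ) ≤ ((F.P K).L : ℝ)⁻¹ := by positivity
  have hx1 : ((F.P K).L : ℝ)⁻¹ ≤ 1 := inv_le_one_of_one_le₀ hL
  unfold Params.eta
  rcases j with _ | j₀
  · rw [pow_zero, mul_one]
    exact (pow_le_one₀ hx0 hx1).trans hL
  · have hj : j₀ ≤ j' := by omega
    calc (((F.P K).L : ℝ)⁻¹) ^ j' ≤ (((F.P K).L : ℝ)⁻¹) ^ j₀ := pow_le_pow_of_le_one hx0 hx1 hj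
      _ = ((F.P K).L : ℝ) * (((F.P K).L : ℝ)⁻¹) ^ (j₀ + 1) := by
          rw [pow_succ, ← mul_assoc, mul_comm ((F.P K).L : ℝ), mul_assoc, mul_inv_cancel₀ hL0.ne', mul_one]

/-- ★ **THE FINE BOUND ON A TOWER BASE FROM THE CLOSED CLASS**: if `U` lies in the closure of NODE 00's strict class (top level `kc`, `0 < εreg`) and a fine plaquette set `S₀` lies in the
levels `j′` with `j′ ≤ kc`, `j ≤ j′ + 1` — `S₀ ⊆ ⋃ plaqsOf (topSeq Ω₀ Ω j′)` — then `|U(∂q) − 1| < (2L²εreg)·η_j²` on `S₀`: the threshold `α₀η_j²`, `α₀ := 2L²εreg`, at which Part 1 runs the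
LOCAL Proposition 2 down a tower of height `j`. [cite: Balaban1985Variational, (2), (7) pp.278–279; Balaban1985RegularSpaces, (1.7) p.77; Balaban1985Averaging, (52) p.26] -/
theorem plaqSmallOn_of_mem_closure_regMSCoPOfRecordAt_of_subset_levels {ν : Stage7Numerics} (hε : 0 < ν.εreg) {kc : ℕ} {Ω₀ : Set (Site (F.P K) 0)}
    {Ω : ℕ → Set (Site (F.P K) 0)} {U : GaugeField (F.P K) 0 (SU N)} (hU : U ∈ closure (regMSCoPOfRecordAt F N ν K kc Ω₀ Ω))
    {j : ℕ} {S₀ : Set (Plaq (F.P K) 0)} (hS₀ : S₀ ⊆ {q | ∃ j', j' ≤ kc ∧ j ≤ j' + 1 ∧ q ∈ plaqsOf (topSeq Ω₀ Ω j')}) :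
    PlaqSmallOn S₀ ((2 * ((F.P K).L : ℝ) ^ 2 * ν.εreg) * (F.P K).eta j ^ 2) U := by
  intro q hq
  obtain ⟨j', hj'k, hjj', hq'⟩ := hS₀ hq
  have hle := dist1_plaqHol_le_of_mem_closure_regMSCoPOfRecordAt hU hj'k hq'
  have hη := eta_le_L_mul_eta (F := F) (K := K) hjj'
  have hη0 : (0 : ℝ) ≤ (F.P K).eta j' := by unfold Params.eta; positivity
  have hηj0 : (0 : ℝ) < (F.P K).eta j := by
    have hL0 : (0 : ℝ) < (F.P K).L := by exact_mod_cast (F.P K).L_pos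
    unfold Params.eta; positivity
  have hL1 : (1 : ℝ) ≤ (F.P K).L := by exact_mod_cast (F.P K).L_pos
  have h2 : (F.P K).eta j' ^ 2 ≤ ((F.P K).L : ℝ) ^ 2 * (F.P K).eta j ^ 2 := by
    rw [← mul_pow]
    exact pow_le_pow_left₀ hη0 hη 2
  calc dist1 (GaugeField.plaqHol U q) ≤ ν.εreg * (F.P K).eta j' ^ 2 := hle
    _ ≤ ν.εreg * (((F.P K).L : ℝ) ^ 2 * (F.P K).eta j ^ 2) := mul_le_mul_of_nonneg_left h2 hε.le
    _ < (2 * ((F.P K).L : ℝ) ^ 2 * ν.εreg) * (F.P K).eta j ^ 2 := by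
        have : 0 < ν.εreg * (((F.P K).L : ℝ) ^ 2 * (F.P K).eta j ^ 2) := by positivity
        nlinarith

/-! ## §4  The class letters at `reg' := closure (regMSCoPOfRecordAt …)` -/

/-- ★★★ **`hDreg'` AT THE CLOSURE OF NODE 00's CLASS ON A SUPPORT**, modulo the geometry letter and the numerics: for a determining set `𝐁` (constrained levels `≤ k`, standing range),
NODE 00's strict class on the support `Ω₀` with top level `kc` and `0 < εreg` satisfying the two Proposition-2 inequalities at `α₀ := 2L²εreg` (`C₀(d)α₀ ≤ ⅓`, `2α₀ ≤ c′₂`), and the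
geometry letter `hgeom` (per constrained bond: a bond tower `B` through it closed downward under the (0.4) window, a box-closed plaquette family `S` holding the three blocks of every
tower bond, fine member inside the levels `j′ ≤ kc`, `j ≤ j′+1`), the `𝐁`-restricted averages are continuous ON `closure (regMSCoPOfRecordAt F N ν K kc Ω₀ Ω)` — the letter `hDreg'`
of E″∕I at the smallest admissible `reg'`. [cite: Balaban1985Variational, (2), (6)–(7) pp.278–279, (16)–(18) p.280; Balaban1985Averaging, Prop. 2 (52)–(54) p.26; Balaban1987RG1, (0.4) p.253; Balaban1988Convergent, (2.10)–(2.13) pp.256–257] -/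
theorem continuousOn_constrainedAverages_closure_regMSCoPOfRecordAt (ν : Stage7Numerics) (hε : 0 < ν.εreg) {k : ℕ} (hk : k ≤ (F.P K).m + (F.P K).K)
    (kc : ℕ) (Ω₀ : Set (Site (F.P K) 0)) (Ω : ℕ → Set (Site (F.P K) 0)) (𝔹 : DetSet (F.P K))
    (hα3 : (143 * (((((F.P K).d + 4 : ℕ) : ℝ)) ^ 2 / 4) ^ 2) * (2 * ((F.P K).L : ℝ) ^ 2 * ν.εreg) ≤ 1 / 3)
    (hα2 : 2 * (2 * ((F.P K).L : ℝ) ^ 2 * ν.εreg) ≤ 2 * deltaSU (Fin N) / ((((F.P K).d + 4) * (F.P K).L : ℕ) : ℝ) ^ 2)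
    (hgeom : ∀ j, j ≤ k → ∀ c ∈ bondsOf (𝔹 j), ∃ (B : (i : ℕ) → Set (PBond (F.P K) i)) (S : (i : ℕ) → Set (Plaq (F.P K) i)),
      c ∈ B j ∧
      (∀ (i : ℕ) (c' : PBond (F.P K) (i + 1)), i + 1 ≤ j → c' ∈ B (i + 1) →
        ∀ b : PBond (F.P K) i, (blockOf b.src = c'.src ∨ blockOf b.src = c'.tgt) → b ∈ B i) ∧
      (∀ (i : ℕ) (c' : PBond (F.P K) (i + 1)), i + 1 ≤ j → c' ∈ B (i + 1) →
        ∀ q : Plaq (F.P K) i, (blockOf q.src = c'.src.unshift c'.dir ∨ blockOf q.src = c'.src ∨ blockOf q.src = c'.tgt) → q ∈ S i) ∧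
      (∀ i, i < j → ∀ p ∈ S (i + 1), (↑(boxRegion (emb p.src) (((F.P K).d + 4) * (F.P K).L + 2)) : Set (Plaq (F.P K) i)) ⊆ S i) ∧
      S 0 ⊆ {q | ∃ j', j' ≤ kc ∧ j ≤ j' + 1 ∧ q ∈ plaqsOf (topSeq Ω₀ Ω j')}) :
    ContinuousOn (fun (U : GaugeField (F.P K) 0 (SU N)) (i : Fin (constrCard 𝔹 k)) =>
      ((avgFamily (avOfRecord F N K) U ((constrEnum 𝔹 k).symm i).1 ((constrEnum 𝔹 k).symm i).2.1 : SU N) : Matrix (Fin N) (Fin N) ℂ))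
      (closure (regMSCoPOfRecordAt F N ν K kc Ω₀ Ω)) := by
  have hL0 : (0 : ℝ) < (F.P K).L := by exact_mod_cast (F.P K).L_pos
  have hα : 0 < 2 * ((F.P K).L : ℝ) ^ 2 * ν.εreg := by positivity
  refine continuousOn_constrainedAverages_of_towerGuards hk 𝔹 _ fun U₀ hU₀ j hj c hc => ?_
  obtain ⟨B, S, hcB, hB, hBS, hS, hS0⟩ := hgeom j hj c hc
  exact ⟨B, hcB, hB, small_iter_of_plaqSmallOn_boxClosed (hj.trans hk) S hS B hBS hα hα3 hα2
    (plaqSmallOn_of_mem_closure_regMSCoPOfRecordAt_of_subset_levels hε hU₀ hS0)⟩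

/-- ★★★ **THE SAME AT THE SUPPORT OF RECORD** `Ω₀ = suppDomOfRecord ν K Ω` (NODE 00's `regMSCoPOfRecord F N ν K kc Ω`, the class literal of E″∕I).
[cite: Balaban1985Variational, (2), (6)–(7) pp.278–279; Balaban1988Convergent, p.255, (2.12)–(2.13) pp.256–257; Balaban1985Averaging, Prop. 2 (52)–(54) p.26] -/
theorem continuousOn_constrainedAverages_closure_regMSCoPOfRecord (ν : Stage7Numerics) (hε : 0 < ν.εreg) {k : ℕ} (hk : k ≤ (F.P K).m + (F.P K).K)
    (kc : ℕ) (Ω : ℕ → Set (Site (F.P K) 0)) (𝔹 : DetSet (F.P K))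
    (hα3 : (143 * (((((F.P K).d + 4 : ℕ) : ℝ)) ^ 2 / 4) ^ 2) * (2 * ((F.P K).L : ℝ) ^ 2 * ν.εreg) ≤ 1 / 3)
    (hα2 : 2 * (2 * ((F.P K).L : ℝ) ^ 2 * ν.εreg) ≤ 2 * deltaSU (Fin N) / ((((F.P K).d + 4) * (F.P K).L : ℕ) : ℝ) ^ 2)
    (hgeom : ∀ j, j ≤ k → ∀ c ∈ bondsOf (𝔹 j), ∃ (B : (i : ℕ) → Set (PBond (F.P K) i)) (S : (i : ℕ) → Set (Plaq (F.P K) i)),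
      c ∈ B j ∧
      (∀ (i : ℕ) (c' : PBond (F.P K) (i + 1)), i + 1 ≤ j → c' ∈ B (i + 1) →
        ∀ b : PBond (F.P K) i, (blockOf b.src = c'.src ∨ blockOf b.src = c'.tgt) → b ∈ B i) ∧
      (∀ (i : ℕ) (c' : PBond (F.P K) (i + 1)), i + 1 ≤ j → c' ∈ B (i + 1) →
        ∀ q : Plaq (F.P K) i, (blockOf q.src = c'.src.unshift c'.dir ∨ blockOf q.src = c'.src ∨ blockOf q.src = c'.tgt) → q ∈ S i) ∧
      (∀ i, i < j → ∀ p ∈ S (i + 1), (↑(boxRegion (emb p.src) (((F.P K).d + 4) * (F.P K).L + 2)) : Set (Plaq (F.P K) i)) ⊆ S i) ∧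
      S 0 ⊆ {q | ∃ j', j' ≤ kc ∧ j ≤ j' + 1 ∧ q ∈ plaqsOf (topSeq (suppDomOfRecord F ν K Ω) Ω j')}) :
    ContinuousOn (fun (U : GaugeField (F.P K) 0 (SU N)) (i : Fin (constrCard 𝔹 k)) =>
      ((avgFamily (avOfRecord F N K) U ((constrEnum 𝔹 k).symm i).1 ((constrEnum 𝔹 k).symm i).2.1 : SU N) : Matrix (Fin N) (Fin N) ℂ))
      (closure (regMSCoPOfRecord F N ν K kc Ω)) :=
  continuousOn_constrainedAverages_closure_regMSCoPOfRecordAt ν hε hk kc (suppDomOfRecord F ν K Ω) Ω 𝔹 hα3 hα2 hgeom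

/-- ★★★ **THE THREE CLASS LETTERS OF E″∕I AT `reg' := closure (regMSCoPOfRecord …)`**, in their binder order: `IsClosed reg'` (a closure), `closure reg ⊆ reg'` (equality), and `hDreg'`
(§4) — modulo the geometry letter and the numerics.  With these, (T1@q₀) of the chart theorems quantifies over the closure of NODE 00's class exactly.
[cite: Balaban1985Variational, Thm 1 p.279, (2), (6)–(7) pp.278–279, (16)–(18) p.280; Balaban1988Convergent, (2.12)–(2.13) pp.256–257; Balaban1985Averaging, Prop. 2 (52)–(54) p.26] -/
theorem classLetters_closure_regMSCoPOfRecord (ν : Stage7Numerics) (hε : 0 < ν.εreg) {k : ℕ} (hk : k ≤ (F.P K).m + (F.P K).K)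
    (kc : ℕ) (Ω : ℕ → Set (Site (F.P K) 0)) (𝔹 : DetSet (F.P K))
    (hα3 : (143 * (((((F.P K).d + 4 : ℕ) : ℝ)) ^ 2 / 4) ^ 2) * (2 * ((F.P K).L : ℝ) ^ 2 * ν.εreg) ≤ 1 / 3)
    (hα2 : 2 * (2 * ((F.P K).L : ℝ) ^ 2 * ν.εreg) ≤ 2 * deltaSU (Fin N) / ((((F.P K).d + 4) * (F.P K).L : ℕ) : ℝ) ^ 2)
    (hgeom : ∀ j, j ≤ k → ∀ c ∈ bondsOf (𝔹 j), ∃ (B : (i : ℕ) → Set (PBond (F.P K) i)) (S : (i : ℕ) → Set (Plaq (F.P K) i)),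
      c ∈ B j ∧
      (∀ (i : ℕ) (c' : PBond (F.P K) (i + 1)), i + 1 ≤ j → c' ∈ B (i + 1) →
        ∀ b : PBond (F.P K) i, (blockOf b.src = c'.src ∨ blockOf b.src = c'.tgt) → b ∈ B i) ∧
      (∀ (i : ℕ) (c' : PBond (F.P K) (i + 1)), i + 1 ≤ j → c' ∈ B (i + 1) →
        ∀ q : Plaq (F.P K) i, (blockOf q.src = c'.src.unshift c'.dir ∨ blockOf q.src = c'.src ∨ blockOf q.src = c'.tgt) → q ∈ S i) ∧
      (∀ i, i < j → ∀ p ∈ S (i + 1), (↑(boxRegion (emb p.src) (((F.P K).d + 4) * (F.P K).L + 2)) : Set (Plaq (F.P K) i)) ⊆ S i) ∧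
      S 0 ⊆ {q | ∃ j', j' ≤ kc ∧ j ≤ j' + 1 ∧ q ∈ plaqsOf (topSeq (suppDomOfRecord F ν K Ω) Ω j')}) :
    IsClosed (closure (regMSCoPOfRecord F N ν K kc Ω)) ∧
      closure (regMSCoPOfRecord F N ν K kc Ω) ⊆ closure (regMSCoPOfRecord F N ν K kc Ω) ∧
      ContinuousOn (fun (U : GaugeField (F.P K) 0 (SU N)) (i : Fin (constrCard 𝔹 k)) =>
        ((avgFamily (avOfRecord F N K) U ((constrEnum 𝔹 k).symm i).1 ((constrEnum 𝔹 k).symm i).2.1 : SU N) : Matrix (Fin N) (Fin N) ℂ))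
        (closure (regMSCoPOfRecord F N ν K kc Ω)) :=
  ⟨isClosed_closure, subset_rfl, continuousOn_constrainedAverages_closure_regMSCoPOfRecord ν hε hk kc Ω 𝔹 hα3 hα2 hgeom⟩

/-! ## §5  The «cone box» editions (the geometry letter in the per-bond packaging Part 3 inhabits at the record) -/

/-- ★★★ **`hDreg'` AT THE CLOSURE OF NODE 00's CLASS ON A SUPPORT, CONE-BOX PACKAGING**: as `continuousOn_constrainedAverages_closure_regMSCoPOfRecordAt`, with the geometry letter
asking, per constrained bond `(j, c)`, a bond family `B ∋ c` closed downward under the (0.4) window below `j` and, for every `c′ ∈ B (i+1)`, `i + 1 ≤ j`, a chain of block centres below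
`emb c′₋` whose bottom fine box `boxRegion (xs 0) (Lⁱ(2L + (d+4)L + 2))` lies in the levels `j′ ≤ kc`, `j ≤ j′ + 1` of the class (no box-closed plaquette family).
[cite: Balaban1985Variational, (2), (6)–(7) pp.278–279, (16)–(18) p.280; Balaban1985Averaging, Prop. 2 (52)–(54) p.26; Balaban1987RG1, (0.4) p.253; Balaban1988Convergent, (2.10)–(2.13) pp.256–257] -/
theorem continuousOn_constrainedAverages_closure_regMSCoPOfRecordAt_of_coneBoxes (ν : Stage7Numerics) (hε : 0 < ν.εreg) {k : ℕ}
    (hk : k ≤ (F.P K).m + (F.P K).K) (kc : ℕ) (Ω₀ : Set (Site (F.P K) 0)) (Ω : ℕ → Set (Site (F.P K) 0)) (𝔹 : DetSet (F.P K))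
    (hα3 : (143 * (((((F.P K).d + 4 : ℕ) : ℝ)) ^ 2 / 4) ^ 2) * (2 * ((F.P K).L : ℝ) ^ 2 * ν.εreg) ≤ 1 / 3)
    (hα2 : 2 * (2 * ((F.P K).L : ℝ) ^ 2 * ν.εreg) ≤ 2 * deltaSU (Fin N) / ((((F.P K).d + 4) * (F.P K).L : ℕ) : ℝ) ^ 2)
    (hgeom : ∀ j, j ≤ k → ∀ c ∈ bondsOf (𝔹 j), ∃ B : (i : ℕ) → Set (PBond (F.P K) i), c ∈ B j ∧
      (∀ (i : ℕ) (c' : PBond (F.P K) (i + 1)), i + 1 ≤ j → c' ∈ B (i + 1) →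
        ∀ b : PBond (F.P K) i, (blockOf b.src = c'.src ∨ blockOf b.src = c'.tgt) → b ∈ B i) ∧
      (∀ (i : ℕ) (c' : PBond (F.P K) (i + 1)), i + 1 ≤ j → c' ∈ B (i + 1) →
        ∃ xs : (l : ℕ) → Site (F.P K) l, xs i = emb c'.src ∧ (∀ l, l < i → xs l = emb (xs (l + 1))) ∧
          (↑(boxRegion (xs 0) ((F.P K).L ^ i * (2 * (F.P K).L + (((F.P K).d + 4) * (F.P K).L + 2)))) : Set (Plaq (F.P K) 0)) ⊆
            {q | ∃ j', j' ≤ kc ∧ j ≤ j' + 1 ∧ q ∈ plaqsOf (topSeq Ω₀ Ω j')})) :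
    ContinuousOn (fun (U : GaugeField (F.P K) 0 (SU N)) (i : Fin (constrCard 𝔹 k)) =>
      ((avgFamily (avOfRecord F N K) U ((constrEnum 𝔹 k).symm i).1 ((constrEnum 𝔹 k).symm i).2.1 : SU N) : Matrix (Fin N) (Fin N) ℂ))
      (closure (regMSCoPOfRecordAt F N ν K kc Ω₀ Ω)) := by
  have hL0 : (0 : ℝ) < (F.P K).L := by exact_mod_cast (F.P K).L_pos
  have hα : 0 < 2 * ((F.P K).L : ℝ) ^ 2 * ν.εreg := by positivity
  refine continuousOn_constrainedAverages_of_towerGuards hk 𝔹 _ fun U₀ hU₀ j hj c hc => ?_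
  obtain ⟨B, hcB, hB, hbox⟩ := hgeom j hj c hc
  refine ⟨B, hcB, hB, fun i c' hi hc' => ?_⟩
  obtain ⟨xs, hxi, hxs, hsub⟩ := hbox i c' hi hc'
  refine small_iter_of_plaqSmallOn_coneBox ((hi.trans hj).trans hk) c' xs hxi hxs hα hα3 hα2 fun q hq => ?_
  have h := plaqSmallOn_of_mem_closure_regMSCoPOfRecordAt_of_subset_levels hε hU₀ hsub q hq
  have hη : (F.P K).eta j ^ 2 ≤ (F.P K).eta i ^ 2 := by
    have h0 : (0 : ℝ) ≤ (F.P K).eta j := by unfold Params.eta; positivity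
    exact pow_le_pow_left₀ h0 (eta_le_eta_of_le (F := F) (K := K) (by omega)) 2
  exact h.trans_le (mul_le_mul_of_nonneg_left hη hα.le)

/-- ★★★ **THE SAME AT THE SUPPORT OF RECORD** (`regMSCoPOfRecord`), cone-box packaging. [cite: Balaban1985Variational, (2), (6)–(7) pp.278–279; Balaban1988Convergent, p.255, (2.12)–(2.13) pp.256–257; Balaban1985Averaging, Prop. 2 (52)–(54) p.26] -/
theorem continuousOn_constrainedAverages_closure_regMSCoPOfRecord_of_coneBoxes (ν : Stage7Numerics) (hε : 0 < ν.εreg) {k : ℕ}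
    (hk : k ≤ (F.P K).m + (F.P K).K) (kc : ℕ) (Ω : ℕ → Set (Site (F.P K) 0)) (𝔹 : DetSet (F.P K))
    (hα3 : (143 * (((((F.P K).d + 4 : ℕ) : ℝ)) ^ 2 / 4) ^ 2) * (2 * ((F.P K).L : ℝ) ^ 2 * ν.εreg) ≤ 1 / 3)
    (hα2 : 2 * (2 * ((F.P K).L : ℝ) ^ 2 * ν.εreg) ≤ 2 * deltaSU (Fin N) / ((((F.P K).d + 4) * (F.P K).L : ℕ) : ℝ) ^ 2)
    (hgeom : ∀ j, j ≤ k → ∀ c ∈ bondsOf (𝔹 j), ∃ B : (i : ℕ) → Set (PBond (F.P K) i), c ∈ B j ∧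
      (∀ (i : ℕ) (c' : PBond (F.P K) (i + 1)), i + 1 ≤ j → c' ∈ B (i + 1) →
        ∀ b : PBond (F.P K) i, (blockOf b.src = c'.src ∨ blockOf b.src = c'.tgt) → b ∈ B i) ∧
      (∀ (i : ℕ) (c' : PBond (F.P K) (i + 1)), i + 1 ≤ j → c' ∈ B (i + 1) →
        ∃ xs : (l : ℕ) → Site (F.P K) l, xs i = emb c'.src ∧ (∀ l, l < i → xs l = emb (xs (l + 1))) ∧
          (↑(boxRegion (xs 0) ((F.P K).L ^ i * (2 * (F.P K).L + (((F.P K).d + 4) * (F.P K).L + 2)))) : Set (Plaq (F.P K) 0)) ⊆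
            {q | ∃ j', j' ≤ kc ∧ j ≤ j' + 1 ∧ q ∈ plaqsOf (topSeq (suppDomOfRecord F ν K Ω) Ω j')})) :
    ContinuousOn (fun (U : GaugeField (F.P K) 0 (SU N)) (i : Fin (constrCard 𝔹 k)) =>
      ((avgFamily (avOfRecord F N K) U ((constrEnum 𝔹 k).symm i).1 ((constrEnum 𝔹 k).symm i).2.1 : SU N) : Matrix (Fin N) (Fin N) ℂ))
      (closure (regMSCoPOfRecord F N ν K kc Ω)) :=
  continuousOn_constrainedAverages_closure_regMSCoPOfRecordAt_of_coneBoxes ν hε hk kc (suppDomOfRecord F ν K Ω) Ω 𝔹 hα3 hα2 hgeom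

/-- ★★★ **THE THREE CLASS LETTERS OF E″∕I AT `reg' := closure (regMSCoPOfRecord …)`, CONE-BOX PACKAGING.**
[cite: Balaban1985Variational, Thm 1 p.279, (2), (6)–(7) pp.278–279, (16)–(18) p.280; Balaban1988Convergent, (2.12)–(2.13) pp.256–257; Balaban1985Averaging, Prop. 2 (52)–(54) p.26] -/
theorem classLetters_closure_regMSCoPOfRecord_of_coneBoxes (ν : Stage7Numerics) (hε : 0 < ν.εreg) {k : ℕ} (hk : k ≤ (F.P K).m + (F.P K).K)
    (kc : ℕ) (Ω : ℕ → Set (Site (F.P K) 0)) (𝔹 : DetSet (F.P K))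
    (hα3 : (143 * (((((F.P K).d + 4 : ℕ) : ℝ)) ^ 2 / 4) ^ 2) * (2 * ((F.P K).L : ℝ) ^ 2 * ν.εreg) ≤ 1 / 3)
    (hα2 : 2 * (2 * ((F.P K).L : ℝ) ^ 2 * ν.εreg) ≤ 2 * deltaSU (Fin N) / ((((F.P K).d + 4) * (F.P K).L : ℕ) : ℝ) ^ 2)
    (hgeom : ∀ j, j ≤ k → ∀ c ∈ bondsOf (𝔹 j), ∃ B : (i : ℕ) → Set (PBond (F.P K) i), c ∈ B j ∧
      (∀ (i : ℕ) (c' : PBond (F.P K) (i + 1)), i + 1 ≤ j → c' ∈ B (i + 1) →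
        ∀ b : PBond (F.P K) i, (blockOf b.src = c'.src ∨ blockOf b.src = c'.tgt) → b ∈ B i) ∧
      (∀ (i : ℕ) (c' : PBond (F.P K) (i + 1)), i + 1 ≤ j → c' ∈ B (i + 1) →
        ∃ xs : (l : ℕ) → Site (F.P K) l, xs i = emb c'.src ∧ (∀ l, l < i → xs l = emb (xs (l + 1))) ∧
          (↑(boxRegion (xs 0) ((F.P K).L ^ i * (2 * (F.P K).L + (((F.P K).d + 4) * (F.P K).L + 2)))) : Set (Plaq (F.P K) 0)) ⊆
            {q | ∃ j', j' ≤ kc ∧ j ≤ j' + 1 ∧ q ∈ plaqsOf (topSeq (suppDomOfRecord F ν K Ω) Ω j')})) :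
    IsClosed (closure (regMSCoPOfRecord F N ν K kc Ω)) ∧
      closure (regMSCoPOfRecord F N ν K kc Ω) ⊆ closure (regMSCoPOfRecord F N ν K kc Ω) ∧
      ContinuousOn (fun (U : GaugeField (F.P K) 0 (SU N)) (i : Fin (constrCard 𝔹 k)) =>
        ((avgFamily (avOfRecord F N K) U ((constrEnum 𝔹 k).symm i).1 ((constrEnum 𝔹 k).symm i).2.1 : SU N) : Matrix (Fin N) (Fin N) ℂ))
        (closure (regMSCoPOfRecord F N ν K kc Ω)) :=
  ⟨isClosed_closure, subset_rfl, continuousOn_constrainedAverages_closure_regMSCoPOfRecord_of_coneBoxes ν hε hk kc Ω 𝔹 hα3 hα2 hgeom⟩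

end Summit.QuantumFields.YangMills.BalabanUVNodes.N12ClassLettersAtClosedClassOfRecord

end
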